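import Literature.NumberTheory.QuadraticForms.HasseInvariantFrames
import Mathlib.LinearAlgebra.BilinearForm.Orthogonal
import HarnessLib

/-!
# Witt's chain equivalence and the invariance of the Hasse product

Topic `NumberTheory/QuadraticForms`; namespace `Literature.NumberTheory.QuadraticForms`. Everything
here is proved; continuation of `HasseInvariantFrames.lean` (frames `f : Fin k → W` for a symmetric
bilinear form `B` over a field `K` with `2 ≠ 0`, abstract Hasse symbols `s`, Hasse products
`∏_{i<j} s (fᵢ.fᵢ) (fⱼ.fⱼ)`).

Main result (`hasseProd_eq_of_span_eq`, `frameInvariance`): two frames with the same span have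
the same Hasse product. This is Serre, *A Course in Arithmetic*, Ch. IV §2.1 Thm. 5 ("`ε(e)` does
not depend on the choice of the orthogonal basis `e`"), whose proof rests on Witt's
chain-equivalence theorem, Ch. IV §1.4 Thm. 2 (two orthogonal bases of a nondegenerate quadratic
module of rank `≥ 3` are linked by a chain of *contiguous* bases, Def. 6), and, in rank `2`, on
the binary invariance of the symbol. We follow Serre's induction on the rank
(`FrameInvariance s B k`):

* rank `≤ 1`: empty products; rank `2`: the binary axiom (`frameInvariance_two`);
* the contiguous case (`hasseProd_eq_of_apply_eq`): frames sharing a vector, by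
  `ε(e) = (a₁, d a₁) ∏_{2≤i<j}(aᵢ, aⱼ)` and the induction hypothesis on the orthogonal complement
  of the shared vector inside the common span;
* the chain (`exists_frame_apply_eq`): every non-isotropic vector `w` of the span of a frame `f`
  of size `≥ 3` belongs to a frame with the same span and Hasse product, by induction on the number
  of frame vectors not orthogonal to `w` — if two or more, two of them `fᵢ, fⱼ` with
  `u = cᵢfᵢ + cⱼfⱼ` non-isotropic (`exists_pair_sum_ne_zero`, using `2 ≠ 0`; Serre's cases
  i)–iii)) are replaced by `u` and its orthogonal in their plane, a contiguous frame (a third vector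
  is untouched) in which `w` involves one vector less;
* conclusion (`frameInvariance_succ`): reach the first vector of `f'` from `f`, then apply the
  contiguous case.

## References

* J.-P. Serre, *A Course in Arithmetic*, GTM 7, Springer 1973, Ch. IV §1.4 (Def. 6, Thm. 2; PDF
  pp. 29–30), §2.1 (Thm. 5; PDF pp. 33–34). [Serre1973]
-/

namespace Literature.NumberTheory.QuadraticForms

open Finset Module

variable {K : Type*} [Field K] {W : Type*} [AddCommGroup W] [Module K W]

/-! ### Frames and Mathlib's `iIsOrtho` -/

namespace IsFrame

variable {B : LinearMap.BilinForm K W} {k : ℕ} {f : Fin k → W}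

/-- The vectors of a frame are pairwise orthogonal in Mathlib's sense `LinearMap.BilinForm.iIsOrtho`.
[folklore] -/
theorem iIsOrtho (hf : IsFrame B f) : B.iIsOrtho f :=
  LinearMap.BilinForm.iIsOrtho_def.mpr hf.ortho

/-- A frame is linearly independent (Mathlib `LinearMap.BilinForm.linearIndependent_of_iIsOrtho`).
[folklore] -/
theorem linearIndependent (hf : IsFrame B f) : LinearIndependent K f :=
  LinearMap.BilinForm.linearIndependent_of_iIsOrtho hf.iIsOrtho hf.ne_zero

/-- A frame of size `finrank K W` spans `W`. [folklore] -/
theorem span_eq_top [FiniteDimensional K W] (hf : IsFrame B f) (hk : k = Module.finrank K W) :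
    Submodule.span K (Set.range f) = ⊤ :=
  hf.linearIndependent.span_eq_top_of_card_eq_finrank' (by rw [Fintype.card_fin, hk])

end IsFrame

/-! ### The invariance statement and the contiguous case -/

/-- `FrameInvariance s B k`: any two frames of size `k` for `B` with the same span have the same
Hasse product — Serre's Ch. IV §2.1 Thm. 5 in rank `k` (the span of a frame is a nondegenerate
quadratic module of rank `k`, of which the frame is an orthogonal basis). [cite: Serre1973, Ch. IV §2.1 Thm. 5] -/
def FrameInvariance (s : K → K → ℤ) (B : LinearMap.BilinForm K W) (k : ℕ) : Prop :=
  ∀ ⦃f f' : Fin k → W⦄, IsFrame B f → IsFrame B f' →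
    Submodule.span K (Set.range f) = Submodule.span K (Set.range f') →
    hasseProd s (fun i => B (f i) (f i)) = hasseProd s (fun i => B (f' i) (f' i))

variable {s : K → K → ℤ} {B : LinearMap.BilinForm K W}

/-- If two frames `g, f'` of size `k+1` share the vector `g i₀ = f' j₀` and `span f' ≤ span g`,
then the remaining vectors of `f'` lie in the span of the remaining vectors of `g` (both are bases
of the orthogonal complement of the shared vector inside the common span — the reduction step in
Serre's proof of Ch. IV §2.1 Thm. 5). [cite: Serre1973, Ch. IV §2.1 Thm. 5] -/
theorem mem_span_succAbove_of_eq {k : ℕ} {g f' : Fin (k + 1) → W} (hg : IsFrame B g)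
    (hf' : IsFrame B f')
    (hle : Submodule.span K (Set.range f') ≤ Submodule.span K (Set.range g))
    {i₀ j₀ : Fin (k + 1)} (he : g i₀ = f' j₀) (j : Fin k) :
    f' (j₀.succAbove j) ∈ Submodule.span K (Set.range fun l => g (i₀.succAbove l)) := by
  set w := f' (j₀.succAbove j) with hw
  have hmem : w ∈ Submodule.span K (Set.range g) := hle (Submodule.subset_span ⟨_, rfl⟩)
  have hexp := hg.eq_sum_smul hmem
  rw [Fin.sum_univ_succAbove _ i₀] at hexp
  have h0 : B w (g i₀) = 0 := by
    rw [he]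
    exact hf'.ortho _ _ (Fin.succAbove_ne j₀ j)
  rw [h0, zero_div, zero_smul, zero_add] at hexp
  rw [hexp]
  exact Submodule.sum_mem _ fun l _ =>
    Submodule.smul_mem _ _ (Submodule.subset_span ⟨l, rfl⟩)

/-- **The contiguous case** (Serre, Ch. IV §2.1, proof of Thm. 5): if invariance holds in rank `k`,
then two frames of size `k+1` with the same span which have a vector in common (*contiguous*
orthogonal bases, Ch. IV §1.4 Def. 6) have the same Hasse product:
`ε(e) = (a₁, d·a₁) ∏_{2≤i<j}(aᵢ, aⱼ)` and induction on the orthogonal complement of the common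
vector. [cite: Serre1973, Ch. IV §2.1 Thm. 5] -/
theorem hasseProd_eq_of_apply_eq (hs : IsHasseSymbol s) (hB : B.IsSymm) {k : ℕ}
    (ih : FrameInvariance s B k) {g f' : Fin (k + 1) → W} (hg : IsFrame B g) (hf' : IsFrame B f')
    (hspan : Submodule.span K (Set.range g) = Submodule.span K (Set.range f'))
    {i₀ j₀ : Fin (k + 1)} (he : g i₀ = f' j₀) :
    hasseProd s (fun i => B (g i) (g i)) = hasseProd s (fun i => B (f' i) (f' i)) := by
  rw [hasseProd_eq_succAbove hs.comm _ i₀, hasseProd_eq_succAbove hs.comm _ j₀]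
  have htg : IsFrame B (fun l => g (i₀.succAbove l)) := hg.comp _ Fin.succAbove_right_injective
  have htf : IsFrame B (fun l => f' (j₀.succAbove l)) := hf'.comp _ Fin.succAbove_right_injective
  have hsub1 : ∀ j, f' (j₀.succAbove j) ∈ Submodule.span K (Set.range fun l => g (i₀.succAbove l)) :=
    mem_span_succAbove_of_eq hg hf' hspan.ge he
  have hsub2 : ∀ j, g (i₀.succAbove j) ∈ Submodule.span K (Set.range fun l => f' (j₀.succAbove l)) :=
    mem_span_succAbove_of_eq hf' hg hspan.le he.symm
  have hspan' := span_range_eq_of_mem hsub2 hsub1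
  -- tails by induction hypothesis
  rw [ih htg htf hspan']
  congr 1
  -- heads: `(a, ∏ others)` with the two discriminants differing by a square
  obtain ⟨c, hc, hprod⟩ := exists_prod_eq_prod_mul_sq hB htg htf hsub1
  have hne : (∏ l, B (g (i₀.succAbove l)) (g (i₀.succAbove l))) ≠ 0 :=
    prod_ne_zero_iff.mpr fun l _ => htg.ne_zero l
  rw [← hs.map_prod_right _ (hg.ne_zero i₀) _ fun l => htg.ne_zero l,
    ← hs.map_prod_right _ (hf'.ne_zero j₀) _ fun l => htf.ne_zero l, hprod, he,
    hs.mul_sq_right _ _ _ (hf'.ne_zero j₀) hne hc]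

/-! ### Reaching a vector by a chain of contiguous frames -/

/-- In a frame, among at least two indices where a non-isotropic vector `w` of the span has nonzero
coefficients, there are two, `i ≠ j`, whose partial sum `cᵢ² (fᵢ.fᵢ) + cⱼ² (fⱼ.fⱼ)` is nonzero
(`2 ≠ 0` in `K`; compare the three cases of Serre's proof of Ch. IV §1.4 Thm. 2 and the identity
`2x.x = …` there). [cite: Serre1973, Ch. IV §1.4 Thm. 2] -/
theorem exists_pair_sum_ne_zero (h2 : (2 : K) ≠ 0) {k : ℕ} {f : Fin k → W} (hf : IsFrame B f)
    {w : W} (hw : w ∈ Submodule.span K (Set.range f)) (hww : B w w ≠ 0)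
    (T : Finset (Fin k)) (hT : ∀ i ∉ T, B w (f i) = 0) (h2T : 2 ≤ T.card) :
    ∃ i ∈ T, ∃ j ∈ T, i ≠ j ∧ B w (f i) ≠ 0 ∧
      (B w (f i) / B (f i) (f i)) ^ 2 * B (f i) (f i) +
        (B w (f j) / B (f j) (f j)) ^ 2 * B (f j) (f j) ≠ 0 := by
  classical
  -- the support of `w` and the terms of `w.w = ∑ cₗ² aₗ`
  set t : Fin k → K := fun l => (B w (f l) / B (f l) (f l)) ^ 2 * B (f l) (f l) with ht
  have ht0 : ∀ l, B w (f l) = 0 → t l = 0 := fun l hl => by simp [ht, hl]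
  have htne : ∀ l, B w (f l) ≠ 0 → t l ≠ 0 := fun l hl =>
    mul_ne_zero (pow_ne_zero 2 (div_ne_zero hl (hf.ne_zero l))) (hf.ne_zero l)
  have hsum : B w w = ∑ l ∈ T, t l := by
    rw [hf.apply_self_eq_sum hw, ← Finset.sum_subset (Finset.subset_univ T)]
    intro l _ hl
    exact ht0 l (hT l hl)
  -- some index of `T` carries a nonzero coefficient
  have hex : ∃ i ∈ T, B w (f i) ≠ 0 := by
    by_contra hcon
    push Not at hcon
    apply hww
    rw [hsum]
    exact Finset.sum_eq_zero fun l hl => ht0 l (hcon l hl)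
  obtain ⟨i, hi, hwi⟩ := hex
  by_contra hall
  push Not at hall
  -- every other index `j ∈ T` has `t j = - t i`
  have hj : ∀ j ∈ T, j ≠ i → t j = -t i := fun j hjT hji =>
    eq_neg_of_add_eq_zero_right (hall i hi j hjT (Ne.symm hji) hwi)
  obtain ⟨j, hjT, hji⟩ := Finset.exists_mem_ne h2T i
  by_cases h3 : ∃ l ∈ T, l ≠ i ∧ l ≠ j
  · obtain ⟨l, hlT, hli, hlj⟩ := h3
    -- `t j + t l = -2 t i ≠ 0` although both `j, l` are admissible partners … of each other
    have hwj : B w (f j) ≠ 0 := fun h0 => by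
      have := hj j hjT hji; rw [ht0 j h0] at this; exact htne i hwi (neg_eq_zero.mp this.symm)
    have hjl := hall j hjT l hlT (Ne.symm hlj) hwj
    change t j + t l = 0 at hjl
    rw [hj j hjT hji, hj l hlT hli, ← neg_add, neg_eq_zero, ← two_mul] at hjl
    exact htne i hwi ((mul_eq_zero.mp hjl).resolve_left h2)
  · -- `T = {i, j}`: then `w.w = t i + t j = 0`
    push Not at h3
    have hT2 : T = {i, j} := by
      ext l
      simp only [Finset.mem_insert, Finset.mem_singleton]
      constructor
      · intro hl
        by_cases hli : l = i
        · exact Or.inl hli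
        · exact Or.inr (h3 l hl hli)
      · rintro (rfl | rfl) <;> assumption
    apply hww
    rw [hsum, hT2, Finset.sum_pair (Ne.symm hji), hj j hjT hji, add_neg_cancel]

/-- **Reaching a vector by contiguous frames** (the chain construction of Witt's theorem, Serre
Ch. IV §1.4 Thm. 2, combined with the contiguous case of Ch. IV §2.1 Thm. 5): assume invariance in
rank `k ≥ 2` and let `f` be a frame of size `k + 1 ≥ 3`. Then every non-isotropic vector `w` of the
span of `f` is a member of some frame `g` with the same span and the same Hasse product as `f`.
Induction on the number `m` of frame vectors not orthogonal to `w`: if `m = 1`, `w` is a multiple of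
some `fᵢ` and we rescale; if `m ≥ 2`, two of these vectors `fᵢ, fⱼ` with `u = cᵢfᵢ + cⱼfⱼ`
non-isotropic (`exists_pair_sum_ne_zero`) are replaced by `u` and its orthogonal `u'` in their
plane — a frame contiguous to `f` (a third vector is untouched) in which `w` involves one vector
less. [cite: Serre1973, Ch. IV §1.4 Thm. 2] -/
theorem exists_frame_apply_eq (hs : IsHasseSymbol s) (hB : B.IsSymm) (h2 : (2 : K) ≠ 0) {k : ℕ}
    (hk : 2 ≤ k) (ih : FrameInvariance s B k) :
    ∀ (m : ℕ) {f : Fin (k + 1) → W} (_hf : IsFrame B f) {w : W}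
      (_hw : w ∈ Submodule.span K (Set.range f)) (_hww : B w w ≠ 0)
      (T : Finset (Fin (k + 1))) (_hT : ∀ i ∉ T, B w (f i) = 0) (_hTm : T.card ≤ m),
      ∃ g : Fin (k + 1) → W, IsFrame B g ∧
        Submodule.span K (Set.range g) = Submodule.span K (Set.range f) ∧
        (∃ i, g i = w) ∧
        hasseProd s (fun i => B (g i) (g i)) = hasseProd s (fun i => B (f i) (f i)) := by
  intro m
  induction m with
  | zero =>
    intro f hf w hw hww T hT hTm
    have hT0 : T = ∅ := Finset.card_eq_zero.mp (Nat.le_zero.mp hTm)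
    refine absurd (hf.eq_zero_of_forall_ortho hw fun i => hT i (by simp [hT0])) fun h0 => hww ?_
    simp [h0]
  | succ m ihm =>
    intro f hf w hw hww T hT hTm
    classical
    -- shrink `T` to the support of `w`
    set S := T.filter fun i => B w (f i) ≠ 0 with hS
    have hS_sub : S ⊆ T := Finset.filter_subset _ _
    have hS_in : ∀ i ∈ S, B w (f i) ≠ 0 := fun i hi => (Finset.mem_filter.mp hi).2
    have hS_out : ∀ i ∉ S, B w (f i) = 0 := by
      intro i hi
      by_contra hne
      by_cases hiT : i ∈ T
      · exact hi (Finset.mem_filter.mpr ⟨hiT, hne⟩)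
      · exact hne (hT i hiT)
    by_cases hSm : S.card ≤ m
    · exact ihm hf hw hww S hS_out hSm
    have hScard : S.card = m + 1 :=
      le_antisymm ((Finset.card_le_card hS_sub).trans hTm) (by omega)
    -- coefficients of `w`
    set c : Fin (k + 1) → K := fun l => B w (f l) / B (f l) (f l) with hc
    have hcN : ∀ l, c l * B (f l) (f l) = B w (f l) := fun l => div_mul_cancel₀ _ (hf.ne_zero l)
    have hwexp : w = ∑ l, c l • f l := hf.eq_sum_smul hw
    rcases Nat.eq_zero_or_pos m with hm | hmpos
    · -- `m = 0`: `w = c • fᵢ₀`, rescale `fᵢ₀`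
      subst hm
      obtain ⟨i₀, hS0⟩ := Finset.card_eq_one.mp hScard
      have hout : ∀ l, l ≠ i₀ → B w (f l) = 0 := fun l hl =>
        hS_out l (by rw [hS0, Finset.mem_singleton]; exact hl)
      have hwi₀ : B w (f i₀) ≠ 0 := hS_in i₀ (by rw [hS0]; exact Finset.mem_singleton_self _)
      have hci₀ : c i₀ ≠ 0 := div_ne_zero hwi₀ (hf.ne_zero i₀)
      have hw1 : w = c i₀ • f i₀ := by
        rw [hwexp, ← Finset.sum_erase_add _ _ (Finset.mem_univ i₀), Finset.sum_eq_zero, zero_add]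
        intro l hl
        have : c l = 0 := by rw [hc]; simp only; rw [hout l (Finset.ne_of_mem_erase hl), zero_div]
        rw [this, zero_smul]
      refine ⟨Function.update f i₀ w, hf.update hB i₀ hout hww, ?_, ⟨i₀, Function.update_self _ _ _⟩, ?_⟩
      · refine span_range_eq_of_mem (fun a => ?_) (fun a => ?_)
        · by_cases ha : a = i₀
          · subst ha; rw [Function.update_self]; exact hw
          · rw [Function.update_of_ne ha]; exact Submodule.subset_span ⟨a, rfl⟩
        · by_cases ha : a = i₀
          · subst ha
            have : f a = (c a)⁻¹ • Function.update f a w a := by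
              rw [Function.update_self, hw1, smul_smul, inv_mul_cancel₀ hci₀, one_smul]
            rw [this]
            exact Submodule.smul_mem _ _ (Submodule.subset_span ⟨a, rfl⟩)
          · rw [← Function.update_of_ne ha w f]
            exact Submodule.subset_span ⟨a, rfl⟩
      · rw [hasseProd_eq_succAbove hs.comm _ i₀,
          hasseProd_eq_succAbove hs.comm (fun i => B (f i) (f i)) i₀]
        have htail : (fun j => B (Function.update f i₀ w (i₀.succAbove j))
            (Function.update f i₀ w (i₀.succAbove j))) =
            fun j => B (f (i₀.succAbove j)) (f (i₀.succAbove j)) := by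
          funext j; rw [Function.update_of_ne (Fin.succAbove_ne i₀ j)]
        rw [htail]
        congr 1
        refine prod_congr rfl fun j _ => ?_
        rw [Function.update_self, Function.update_of_ne (Fin.succAbove_ne i₀ j)]
        have hNw : B w w = B (f i₀) (f i₀) * c i₀ ^ 2 := by
          rw [hw1]; simp only [map_smul, LinearMap.smul_apply, smul_eq_mul]; ring
        rw [hNw, hs.mul_sq_left _ _ _ (hf.ne_zero i₀) (hf.ne_zero _) hci₀]
    · -- `m ≥ 1`: at least two vectors involved; replace two of them
      obtain ⟨i, hiS, j, hjS, hij, hwi, hsum⟩ :=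
        exists_pair_sum_ne_zero h2 hf hw hww S hS_out (by omega)
      set u : W := c i • f i + c j • f j with hu
      set u' : W := (c j * B (f j) (f j)) • f i - (c i * B (f i) (f i)) • f j with hu'
      have hfifj : B (f i) (f j) = 0 := hf.ortho i j hij
      have hfjfi : B (f j) (f i) = 0 := hf.ortho j i hij.symm
      have hBuu : B u u = c i ^ 2 * B (f i) (f i) + c j ^ 2 * B (f j) (f j) := by
        simp only [hu, map_add, map_smul, LinearMap.add_apply, LinearMap.smul_apply, smul_eq_mul,
          hfifj, hfjfi]
        ring
      have hBuu_ne : B u u ≠ 0 := by rw [hBuu]; exact hsum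
      have hBuu' : B u u' = 0 := by
        simp only [hu, hu', map_add, map_sub, map_smul, LinearMap.add_apply,
          LinearMap.smul_apply, smul_eq_mul, hfifj, hfjfi]
        ring
      have hBu'u' : B u' u' = B (f i) (f i) * B (f j) (f j) * B u u := by
        rw [hBuu]
        simp only [hu', map_sub, map_smul, LinearMap.sub_apply, LinearMap.smul_apply, smul_eq_mul,
          hfifj, hfjfi]
        ring
      have hBu'u'_ne : B u' u' ≠ 0 := by
        rw [hBu'u']; exact mul_ne_zero (mul_ne_zero (hf.ne_zero i) (hf.ne_zero j)) hBuu_ne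
      have hBwu : B w u = B u u := by
        rw [hBuu]
        simp only [hu, map_add, map_smul, smul_eq_mul]
        rw [← hcN i, ← hcN j]; ring
      have hBwu' : B w u' = 0 := by
        simp only [hu', map_sub, map_smul, smul_eq_mul]
        rw [← hcN i, ← hcN j]; ring
      have hu_orth : ∀ l, l ≠ i → l ≠ j → B u (f l) = 0 := fun l hli hlj => by
        simp only [hu, map_add, map_smul, LinearMap.add_apply, LinearMap.smul_apply, smul_eq_mul,
          hf.ortho i l (Ne.symm hli), hf.ortho j l (Ne.symm hlj), mul_zero, add_zero]
      have hu'_orth : ∀ l, l ≠ i → l ≠ j → B u' (f l) = 0 := fun l hli hlj => by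
        simp only [hu', map_sub, map_smul, LinearMap.sub_apply, LinearMap.smul_apply, smul_eq_mul,
          hf.ortho i l (Ne.symm hli), hf.ortho j l (Ne.symm hlj), mul_zero, sub_zero]
      set g := Function.update (Function.update f i u) j u' with hg
      have hgf : IsFrame B g := hf.update_update hB hij hBuu' hu_orth hu'_orth hBuu_ne hBu'u'_ne
      have hgi : g i = u := by rw [hg, Function.update_of_ne hij, Function.update_self]
      have hgj : g j = u' := by rw [hg, Function.update_self]
      have hgl : ∀ l, l ≠ i → l ≠ j → g l = f l := fun l hli hlj => by
        rw [hg, Function.update_of_ne hlj, Function.update_of_ne hli]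
      -- spans
      have hfi_mem : f i ∈ Submodule.span K (Set.range f) := Submodule.subset_span ⟨i, rfl⟩
      have hfj_mem : f j ∈ Submodule.span K (Set.range f) := Submodule.subset_span ⟨j, rfl⟩
      have hu_mem : u ∈ Submodule.span K (Set.range f) :=
        Submodule.add_mem _ (Submodule.smul_mem _ _ hfi_mem) (Submodule.smul_mem _ _ hfj_mem)
      have hu'_mem : u' ∈ Submodule.span K (Set.range f) :=
        Submodule.sub_mem _ (Submodule.smul_mem _ _ hfi_mem) (Submodule.smul_mem _ _ hfj_mem)
      have hg_mem : ∀ a, g a ∈ Submodule.span K (Set.range f) := by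
        intro a
        by_cases haj : a = j
        · rw [haj, hgj]; exact hu'_mem
        · by_cases hai : a = i
          · rw [hai, hgi]; exact hu_mem
          · rw [hgl a hai haj]; exact Submodule.subset_span ⟨a, rfl⟩
      have hgu : u ∈ Submodule.span K (Set.range g) := hgi ▸ Submodule.subset_span ⟨i, rfl⟩
      have hgu' : u' ∈ Submodule.span K (Set.range g) := hgj ▸ Submodule.subset_span ⟨j, rfl⟩
      have hfi : f i = (B u u)⁻¹ • ((c i * B (f i) (f i)) • u + c j • u') := by
        have key : (c i * B (f i) (f i)) • u + c j • u' = (B u u) • f i := by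
          rw [hBuu, hu, hu']; module
        rw [key, smul_smul, inv_mul_cancel₀ hBuu_ne, one_smul]
      have hfj : f j = (B u u)⁻¹ • ((c j * B (f j) (f j)) • u - c i • u') := by
        have key : (c j * B (f j) (f j)) • u - c i • u' = (B u u) • f j := by
          rw [hBuu, hu, hu']; module
        rw [key, smul_smul, inv_mul_cancel₀ hBuu_ne, one_smul]
      have hf_mem : ∀ a, f a ∈ Submodule.span K (Set.range g) := by
        intro a
        by_cases haj : a = j
        · rw [haj, hfj]
          exact Submodule.smul_mem _ _ (Submodule.sub_mem _ (Submodule.smul_mem _ _ hgu)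
            (Submodule.smul_mem _ _ hgu'))
        · by_cases hai : a = i
          · rw [hai, hfi]
            exact Submodule.smul_mem _ _ (Submodule.add_mem _ (Submodule.smul_mem _ _ hgu)
              (Submodule.smul_mem _ _ hgu'))
          · rw [← hgl a hai haj]; exact Submodule.subset_span ⟨a, rfl⟩
      have hspan_g : Submodule.span K (Set.range g) = Submodule.span K (Set.range f) :=
        span_range_eq_of_mem hg_mem hf_mem
      -- a third, untouched, vector: `g` and `f` are contiguous
      obtain ⟨l, -, hl⟩ : ∃ l ∈ (Finset.univ : Finset (Fin (k + 1))), l ∉ ({i, j} : Finset _) :=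
        Finset.exists_mem_notMem_of_card_lt_card
          (lt_of_le_of_lt Finset.card_le_two (by rw [Finset.card_univ, Fintype.card_fin]; omega))
      simp only [Finset.mem_insert, Finset.mem_singleton, not_or] at hl
      have hHg : hasseProd s (fun a => B (g a) (g a)) = hasseProd s (fun a => B (f a) (f a)) :=
        hasseProd_eq_of_apply_eq hs hB ih hgf hf hspan_g (hgl l hl.1 hl.2)
      -- in `g`, `w` involves one vector less
      have hT' : ∀ a ∉ S.erase j, B w (g a) = 0 := by
        intro a ha
        by_cases haj : a = j
        · rw [haj, hgj]; exact hBwu'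
        · have haS : a ∉ S := fun haS => ha (Finset.mem_erase.mpr ⟨haj, haS⟩)
          have hai : a ≠ i := fun hai => haS (hai ▸ hiS)
          rw [hgl a hai haj]; exact hS_out a haS
      have hcard' : (S.erase j).card ≤ m := by
        rw [Finset.card_erase_of_mem hjS, hScard]; omega
      have hw_g : w ∈ Submodule.span K (Set.range g) := hspan_g ▸ hw
      obtain ⟨g', hg'f, hspan', hmem', hH'⟩ := ihm hgf hw_g hww (S.erase j) hT' hcard'
      exact ⟨g', hg'f, hspan'.trans hspan_g, hmem', hH'.trans hHg⟩

/-! ### Invariance -/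

/-- Invariance in rank `0` (empty products). [folklore] -/
theorem frameInvariance_zero : FrameInvariance s B 0 := fun f f' _ _ _ => by simp

/-- Invariance in rank `1` (empty products; Serre: "if `n = 1`, one has `ε(e) = 1`").
[cite: Serre1973, Ch. IV §2.1 Thm. 5] -/
theorem frameInvariance_one : FrameInvariance s B 1 := fun f f' _ _ _ => by simp

/-- Invariance in rank `2`: `⟨a, b⟩ ≅ ⟨a', b'⟩` with `a' = a x² + b y²`, `a' b' = a b c²`, and the
binary axiom of the symbol (Serre: "if `n = 2`, `ε(e) = 1` iff `a₁X² + a₂Y²` represents `1`, which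
does not depend on `e`"). [cite: Serre1973, Ch. IV §2.1 Thm. 5] -/
theorem frameInvariance_two (hs : IsHasseSymbol s) (hB : B.IsSymm) : FrameInvariance s B 2 := by
  intro f f' hf hf' hspan
  rw [hasseProd_two, hasseProd_two]
  have hmem : ∀ i, f' i ∈ Submodule.span K (Set.range f) := fun i => by
    rw [hspan]; exact Submodule.subset_span ⟨i, rfl⟩
  obtain ⟨c, hc, hprod⟩ := exists_prod_eq_prod_mul_sq hB hf hf' hmem
  simp only [Fin.prod_univ_two] at hprod
  have ha' := hf.apply_self_eq_sum (hmem 0)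
  simp only [Fin.sum_univ_two] at ha'
  exact hs.binary _ _ _ _ (B (f' 0) (f 0) / B (f 0) (f 0)) (B (f' 0) (f 1) / B (f 1) (f 1)) c
    (hf.ne_zero 0) (hf.ne_zero 1) (hf'.ne_zero 0) (hf'.ne_zero 1) hc (by rw [ha']; ring) hprod

/-- Invariance in rank `k + 1 ≥ 3` from rank `k`: reach the first vector of `f'` from `f`
(`exists_frame_apply_eq`) and conclude by the contiguous case. [cite: Serre1973, Ch. IV §2.1 Thm. 5] -/
theorem frameInvariance_succ (hs : IsHasseSymbol s) (hB : B.IsSymm) (h2 : (2 : K) ≠ 0) {k : ℕ}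
    (hk : 2 ≤ k) (ih : FrameInvariance s B k) : FrameInvariance s B (k + 1) := by
  intro f f' hf hf' hspan
  have hw : f' 0 ∈ Submodule.span K (Set.range f) := by
    rw [hspan]; exact Submodule.subset_span ⟨0, rfl⟩
  obtain ⟨g, hg, hspan_g, ⟨i₀, hi₀⟩, hH⟩ := exists_frame_apply_eq hs hB h2 hk ih (k + 1) hf hw
    (hf'.ne_zero 0) Finset.univ (fun i hi => absurd (Finset.mem_univ i) hi) (by simp)
  rw [← hH]
  exact hasseProd_eq_of_apply_eq hs hB ih hg hf' (hspan_g.trans hspan) hi₀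

/-- **Invariance of the Hasse product** (Serre, *A Course in Arithmetic*, Ch. IV §2.1 Thm. 5, for
an abstract Hasse symbol over a field with `2 ≠ 0`): in every rank `k`, two frames with the same
span have the same Hasse product `∏_{i<j} s (fᵢ.fᵢ) (fⱼ.fⱼ)`. [cite: Serre1973, Ch. IV §2.1 Thm. 5] -/
theorem frameInvariance (hs : IsHasseSymbol s) (hB : B.IsSymm) (h2 : (2 : K) ≠ 0) :
    ∀ k, FrameInvariance s B k
  | 0 => frameInvariance_zero
  | 1 => frameInvariance_one
  | 2 => frameInvariance_two hs hB
  | (k + 3) => frameInvariance_succ hs hB h2 (by omega) (frameInvariance hs hB h2 (k + 2))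

/-- **Invariance of the Hasse product**, unbundled form: for a symmetric bilinear form `B` over a
field with `2 ≠ 0` and a Hasse symbol `s`, two frames `f, f' : Fin k → W` (pairwise orthogonal,
nonzero squares) spanning the same subspace satisfy
`∏_{i<j} s (fᵢ.fᵢ) (fⱼ.fⱼ) = ∏_{i<j} s (f'ᵢ.f'ᵢ) (f'ⱼ.f'ⱼ)` (Serre, Ch. IV §2.1 Thm. 5: `ε` is an
invariant of the quadratic module). [cite: Serre1973, Ch. IV §2.1 Thm. 5] -/
theorem hasseProd_eq_of_span_eq (hs : IsHasseSymbol s) (hB : B.IsSymm) (h2 : (2 : K) ≠ 0) {k : ℕ}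
    {f f' : Fin k → W} (hf : IsFrame B f) (hf' : IsFrame B f')
    (hspan : Submodule.span K (Set.range f) = Submodule.span K (Set.range f')) :
    hasseProd s (fun i => B (f i) (f i)) = hasseProd s (fun i => B (f' i) (f' i)) :=
  frameInvariance hs hB h2 k hf hf' hspan

end Literature.NumberTheory.QuadraticForms
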